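import Mathlib
import Summits.Ventures.PercRepro2.Defs
import Summits.Ventures.PercRepro2.Harris
import Summits.Ventures.PercRepro2.Graph
import Summits.Ventures.PercRepro2.Events
import Summits.Ventures.PercRepro2.Induced
import Summits.Ventures.PercRepro2.BHK
import Summits.Ventures.PercRepro2.BHKEvents
import Summits.Ventures.PercRepro2.VdBKahn
import Summits.Ventures.PercRepro2.BHKAvoid
import Summits.Ventures.PercRepro2.OneEdge
import Summits.Ventures.PercRepro2.KPrimeReduction
import Summits.Ventures.PercRepro2.KPrimeBase

/-!
# The sure set, the weight-`1` root of `a₂`, and the base cases of the `a₂`-frontier induction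
for `(K′)` (blind cell PercRepro2, mine-c g32; `conjectures/MINE-C.md` §41.3;
`proofs/MINEC-KPRIME-INDUCTION.md`)

Part I of the kernel form of the induction frame «`(STEP′) ⟹ (K′)`» (`KPrimeInduction.lean`).
`sureSet p` = the configurations with every weight-`1` edge open and every weight-`0` edge closed;
its complement has weight `0`, so every probability is carried by it (`prob_eq_prob_inter_sureSet`).
`root p ends a₂` = the vertices reached from `a₂` through weight-`1` edges (`C₂ ⊇ root` on the sure
set).  `KPrimeHolds … p` = `(K′)` for the weight vector `p` (`kprimeForm` of `KPrimeReduction.lean`).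
When the root is EXHAUSTED (every edge leaving it has weight `0`) and avoids `a₁, v, y`, `C₂ = root`
on the sure set, `y ∉ C₂`, `Ω = S =` everything, and `(K′)` is the isolated case of `KPrimeBase.lean`
(van den Berg–Kahn `vdBK_pair` plus the `χ`-mass): `kprime_of_exhausted`.  The degenerate cases
`a₁ ∈ root` (every `Ω`-mass vanishes), `v ∈ root` (every `S`-mass vanishes) and `y ∈ root` (the
form vanishes identically) are `kprimeHolds_of_a₁_mem_root`, `kprimeHolds_of_v_mem_root`,
`kprime_of_exhausted_y`.
-/

namespace Summit.Ventures.PercRepro2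

namespace KPrime

variable {V : Type*} {E : Type*} [Fintype E] [DecidableEq E] [Fintype V] [DecidableEq V]
  {R : Type*} [Field R] [LinearOrder R] [IsStrictOrderedRing R]

/-! ## The sure set of a weight vector -/

section Sure

variable (p : E → R)

/-- The configurations compatible with the resolved edges of `p`: every weight-`1` edge open and
every weight-`0` edge closed. Its complement has weight `0`. -/
def sureSet : Set (Config E) :=
  {ω | (∀ e, p e = 1 → ω e = true) ∧ (∀ e, p e = 0 → ω e = false)}

omit [Fintype V] [DecidableEq V] [LinearOrder R] [IsStrictOrderedRing R] in
/-- Off the sure set the weight vanishes. -/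
lemma weight_eq_zero_of_not_mem_sureSet {ω : Config E} (h : ω ∉ sureSet p) : weight p ω = 0 := by
  unfold sureSet at h
  simp only [Set.mem_setOf_eq, not_and_or, not_forall] at h
  rcases h with ⟨e, he, hω⟩ | ⟨e, he, hω⟩
  · rw [weight_eq_mul_edgeFactor p ω e]
    simp only [Bool.not_eq_true] at hω
    simp [he, hω]
  · rw [weight_eq_mul_edgeFactor p ω e]
    simp only [Bool.not_eq_false] at hω
    simp [he, hω]

omit [Fintype V] [DecidableEq V] [LinearOrder R] [IsStrictOrderedRing R] in
/-- Every probability is carried by the sure set. -/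
lemma prob_eq_prob_inter_sureSet (A : Set (Config E)) :
    prob p A = prob p (A ∩ sureSet p) := by
  unfold prob
  refine Finset.sum_congr rfl fun ω _ => ?_
  by_cases h : ω ∈ sureSet p
  · by_cases hA : ω ∈ A <;> simp [hA, h]
  · simp [h, weight_eq_zero_of_not_mem_sureSet p h]

omit [Fintype V] [DecidableEq V] [LinearOrder R] [IsStrictOrderedRing R] in
/-- Events agreeing on the sure set have the same probability. -/
lemma prob_congr_sure {A B : Set (Config E)} (h : A ∩ sureSet p = B ∩ sureSet p) :
    prob p A = prob p B := by
  rw [prob_eq_prob_inter_sureSet p A, h, ← prob_eq_prob_inter_sureSet]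

omit [Fintype V] [DecidableEq V] [LinearOrder R] [IsStrictOrderedRing R] in
/-- An event missing the sure set is null. -/
lemma prob_eq_zero_of_inter_sureSet_eq_empty {A : Set (Config E)} (h : A ∩ sureSet p = ∅) :
    prob p A = 0 := by
  rw [prob_eq_prob_inter_sureSet p A, h, prob_empty]

/-- The configuration with exactly the weight-`1` edges open. -/
def oneConfig : Config E := fun e => decide (p e = 1)

omit [Fintype E] [DecidableEq E] [Fintype V] [DecidableEq V] [IsStrictOrderedRing R] in
/-- On the sure set every weight-`1` edge is open. -/
lemma oneConfig_le_of_mem_sureSet {ω : Config E} (h : ω ∈ sureSet p) : oneConfig p ≤ ω := by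
  intro e
  simp only [oneConfig]
  by_cases he : p e = 1
  · simp [he, h.1 e he]
  · simp [he]

/-- The weight-`1` root of `a₂`: the vertices reached from `a₂` through weight-`1` edges. -/
def root (ends : E → Sym2 V) (a₂ : V) : Set V := {x | Conn ends (oneConfig p) a₂ x}

omit [Fintype E] [DecidableEq E] [Fintype V] [DecidableEq V] [IsStrictOrderedRing R] in
/-- On the sure set, every root vertex is connected to `a₂`. -/
lemma conn_of_mem_root {ends : E → Sym2 V} {a₂ x : V} {ω : Config E} (hω : ω ∈ sureSet p)
    (hx : x ∈ root p ends a₂) : Conn ends ω a₂ x :=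
  conn_mono (oneConfig_le_of_mem_sureSet p hω) hx

omit [Fintype E] [DecidableEq E] [Fintype V] [DecidableEq V] [IsStrictOrderedRing R] in
/-- `a₂` is in its root. -/
lemma a₂_mem_root (ends : E → Sym2 V) (a₂ : V) : a₂ ∈ root p ends a₂ := conn_refl _ _ _

omit [Fintype E] [DecidableEq E] [Fintype V] [DecidableEq V] [IsStrictOrderedRing R] in
/-- A weight-`1` edge at a root vertex leads into the root. -/
lemma mem_root_of_one {ends : E → Sym2 V} {a₂ : V} {e : E} {x z : V} (hends : ends e = s(x, z))
    (hx : x ∈ root p ends a₂) (he : p e = 1) : z ∈ root p ends a₂ :=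
  conn_trans hx (conn_of_openAdj ⟨e, by simp [oneConfig, he], hends⟩)

/-- `p` is EXHAUSTED at the root of `a₂`: every edge with one end in the root and the other end
outside has weight `0`. -/
def Exhausted (ends : E → Sym2 V) (a₂ : V) : Prop :=
  ∀ e x z, ends e = s(x, z) → x ∈ root p ends a₂ → z ∉ root p ends a₂ → p e = 0

omit [Fintype E] [DecidableEq E] [Fintype V] [DecidableEq V] [IsStrictOrderedRing R] in
/-- Exhausted at the root and on the sure set: whatever `a₂` reaches is in the root. -/
lemma mem_root_of_conn {ends : E → Sym2 V} {a₂ x : V} (hex : Exhausted p ends a₂) {ω : Config E}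
    (hω : ω ∈ sureSet p) (h : Conn ends ω a₂ x) : x ∈ root p ends a₂ := by
  refine mem_of_conn_of_closed (S := root p ends a₂) ?_ (a₂_mem_root p ends a₂) h
  intro u hu w huw
  rw [openGraph_adj] at huw
  obtain ⟨_, e, he, hends⟩ := huw
  by_contra hw
  have h0 := hω.2 e (hex e u w hends hu hw)
  rw [he] at h0
  exact Bool.noConfusion h0

end Sure

/-! ## `(K′)` as a predicate on weight vectors -/

section Holds

variable (ends : E → Sym2 V) (a₁ a₂ b v y : V)

/-- `(K′)` for the weight vector `p`: `0 ≤ kprimeForm … (P(b ∈ C₁, N)) (P(N))`. -/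
def KPrimeHolds (p : E → R) : Prop :=
  0 ≤ kprimeForm ends a₁ a₂ b v y p (prob p (connEvent ends a₁ b ∩ N ends a₁ a₂ v))
    (prob p (N ends a₁ a₂ v))

end Holds

/-! ## The base case: the root is exhausted -/

section Base

variable {ends : E → Sym2 V} {a₁ a₂ b v y : V} {p : E → R}

omit [Fintype E] [DecidableEq E] [Fintype V] [DecidableEq V] [IsStrictOrderedRing R] in
/-- `a₁ ∈ root` kills `Ω` on the sure set. -/
lemma Ω_inter_sureSet_eq_empty_of_mem (h1 : a₁ ∈ root p ends a₂) :
    Ω ends a₁ a₂ ∩ sureSet p = ∅ := by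
  ext ω
  simp only [Set.mem_inter_iff, mem_Ω, Set.mem_empty_iff_false, iff_false, not_and]
  intro hΩ hω
  exact hΩ (conn_symm (conn_of_mem_root p hω h1))

omit [Fintype E] [DecidableEq E] [Fintype V] [IsStrictOrderedRing R] in
/-- `v ∈ root` kills `S` on the sure set. -/
lemma S_inter_sureSet_eq_empty_of_mem (hv : v ∈ root p ends a₂) :
    S ends a₁ a₂ v ∩ sureSet p = ∅ := by
  ext ω
  simp only [Set.mem_inter_iff, mem_S, Set.mem_empty_iff_false, iff_false, not_and]
  intro hS hω
  exact hS.2 (conn_of_mem_root p hω hv)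

omit [Fintype E] [DecidableEq E] [Fintype V] [LinearOrder R] [IsStrictOrderedRing R] in
/-- `S ⊆ Ω`. -/
lemma S_subset_Ω : S ends a₁ a₂ v ⊆ Ω ends a₁ a₂ := by
  intro ω hω
  rw [mem_S] at hω
  rw [mem_Ω]
  exact fun h => hω.1 (conn_symm h)

omit [Fintype V] [IsStrictOrderedRing R] in
/-- **Degenerate base case `a₁ ∈ root`**: `(K′)` holds (every `Ω`-mass vanishes). -/
theorem kprimeHolds_of_a₁_mem_root (h1 : a₁ ∈ root p ends a₂) :
    KPrimeHolds ends a₁ a₂ b v y p := by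
  have hΩ : Ω ends a₁ a₂ ∩ sureSet p = ∅ := Ω_inter_sureSet_eq_empty_of_mem h1
  have hnull : ∀ A : Set (Config E), A ⊆ Ω ends a₁ a₂ → prob p A = 0 := fun A hA =>
    prob_eq_zero_of_inter_sureSet_eq_empty p
      (Set.subset_empty_iff.1 (hΩ ▸ Set.inter_subset_inter_left _ hA))
  unfold KPrimeHolds kprimeForm
  rw [hnull _ Set.inter_subset_right, hnull _ Set.inter_subset_right,
    hnull _ (S_subset_Ω), hnull _ Set.inter_subset_right, hnull _ Set.inter_subset_right]
  simp

omit [Fintype V] [IsStrictOrderedRing R] in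
/-- **Degenerate base case `v ∈ root`**: `(K′)` holds (every `S`-mass vanishes). -/
theorem kprimeHolds_of_v_mem_root (hv : v ∈ root p ends a₂) :
    KPrimeHolds ends a₁ a₂ b v y p := by
  have hS : S ends a₁ a₂ v ∩ sureSet p = ∅ := S_inter_sureSet_eq_empty_of_mem hv
  have hnull : ∀ A : Set (Config E), A ⊆ S ends a₁ a₂ v → prob p A = 0 := fun A hA =>
    prob_eq_zero_of_inter_sureSet_eq_empty p
      (Set.subset_empty_iff.1 (hS ▸ Set.inter_subset_inter_left _ hA))
  unfold KPrimeHolds kprimeForm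
  rw [hnull _ Set.inter_subset_right, hnull _ (subset_refl _)]
  simp

omit [Fintype E] [DecidableEq E] [Fintype V] [DecidableEq V] [IsStrictOrderedRing R] in
/-- On the sure set of an exhausted root avoiding `a₁, v, y`: `a₂` reaches none of them. -/
lemma sure_facts (hex : Exhausted p ends a₂) (h1 : a₁ ∉ root p ends a₂) (hv : v ∉ root p ends a₂)
    (hy : y ∉ root p ends a₂) {ω : Config E} (hω : ω ∈ sureSet p) :
    ¬ Conn ends ω a₂ a₁ ∧ ¬ Conn ends ω a₁ a₂ ∧ ¬ Conn ends ω a₂ v ∧ ¬ Conn ends ω a₂ y :=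
  ⟨fun h => h1 (mem_root_of_conn p hex hω h), fun h => h1 (mem_root_of_conn p hex hω (conn_symm h)),
    fun h => hv (mem_root_of_conn p hex hω h), fun h => hy (mem_root_of_conn p hex hω h)⟩

/-- **The base case of the `a₂`-frontier induction**: the root of `a₂` is exhausted (every edge
leaving it has weight `0`) and avoids `a₁, v, y`.  Then `C₂ = root` on the sure set, `y ∉ C₂`,
`Ω = S = everything`, and `(K′)` is the isolated case of `KPrimeBase.lean`: van den Berg–Kahn
(`vdBK_pair`) plus the `χ`-mass. -/
theorem kprime_of_exhausted (hp : IsProbVec p) (hex : Exhausted p ends a₂)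
    (h1 : a₁ ∉ root p ends a₂) (hv : v ∉ root p ends a₂) (hy : y ∉ root p ends a₂) :
    KPrimeHolds ends a₁ a₂ b v y p := by
  have F := fun {ω : Config E} (hω : ω ∈ sureSet p) => sure_facts hex h1 hv hy hω
  set U := connEvent ends a₁ v with hU
  set X := connEvent ends a₁ b with hX
  set W := connEvent ends a₁ y with hW
  set Cv := connEvent ends v b with hCv
  have e1 : prob p (U ∩ X ∩ Ω ends a₁ a₂) = prob p (U ∩ X) := prob_congr_sure p (by
    ext ω; simp only [Set.mem_inter_iff, mem_Ω]
    constructor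
    · rintro ⟨⟨hu, hx⟩, hω⟩; exact ⟨hu, hω⟩
    · rintro ⟨⟨hu, hx⟩, hω⟩; exact ⟨⟨⟨hu, hx⟩, (F hω).2.1⟩, hω⟩)
  have e2 : prob p (U ∩ Ω ends a₁ a₂) = prob p U := prob_congr_sure p (by
    ext ω; simp only [Set.mem_inter_iff, mem_Ω]
    constructor
    · rintro ⟨⟨hu, _⟩, hω⟩; exact ⟨hu, hω⟩
    · rintro ⟨hu, hω⟩; exact ⟨⟨hu, (F hω).2.1⟩, hω⟩)
  have e3 : prob p (connEvent ends a₂ y ∩ S ends a₁ a₂ v) = 0 :=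
    prob_eq_zero_of_inter_sureSet_eq_empty p (by
      ext ω; simp only [Set.mem_inter_iff, mem_connEvent, Set.mem_empty_iff_false, iff_false, not_and]
      intro hy' hω; exact (F hω).2.2.2 hy'.1)
  have e4 : prob p (S ends a₁ a₂ v) = 1 := by
    rw [← prob_univ p]
    exact prob_congr_sure p (by
      ext ω; simp only [Set.mem_inter_iff, mem_S, Set.mem_univ, true_and]
      constructor
      · rintro ⟨_, hω⟩; exact hω
      · intro hω; exact ⟨⟨(F hω).1, (F hω).2.2.1⟩, hω⟩)
  have e5 : prob p (cls01e ends a₁ a₂ b v y) = prob p (Uᶜ ∩ W ∩ (X ∪ Cv)) := prob_congr_sure p (by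
    ext ω; simp only [cls01e, Set.mem_inter_iff, mem_S, Set.mem_compl_iff, Set.mem_union]
    constructor
    · rintro ⟨⟨⟨⟨hu, hw⟩, _⟩, hx⟩, hω⟩; exact ⟨⟨⟨hu, hw⟩, hx⟩, hω⟩
    · rintro ⟨⟨⟨hu, hw⟩, hx⟩, hω⟩; exact ⟨⟨⟨⟨hu, hw⟩, (F hω).1, (F hω).2.2.1⟩, hx⟩, hω⟩)
  have e6 : prob p (cls01 ends a₁ a₂ v y) = prob p (Uᶜ ∩ W) := prob_congr_sure p (by
    ext ω; simp only [cls01, Set.mem_inter_iff, mem_S, Set.mem_compl_iff]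
    constructor
    · rintro ⟨⟨⟨hu, hw⟩, _⟩, hω⟩; exact ⟨⟨hu, hw⟩, hω⟩
    · rintro ⟨⟨hu, hw⟩, hω⟩; exact ⟨⟨⟨hu, hw⟩, (F hω).1, (F hω).2.2.1⟩, hω⟩)
  have e7 : prob p (U ∩ connEvent ends a₂ y ∩ X ∩ Ω ends a₁ a₂) = 0 :=
    prob_eq_zero_of_inter_sureSet_eq_empty p (by
      ext ω; simp only [Set.mem_inter_iff, mem_connEvent, Set.mem_empty_iff_false, iff_false, not_and]
      rintro ⟨⟨⟨_, hy'⟩, _⟩, _⟩ hω; exact (F hω).2.2.2 hy')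
  have e8 : prob p (U ∩ connEvent ends a₂ y ∩ Ω ends a₁ a₂) = 0 :=
    prob_eq_zero_of_inter_sureSet_eq_empty p (by
      ext ω; simp only [Set.mem_inter_iff, mem_connEvent, Set.mem_empty_iff_false, iff_false, not_and]
      rintro ⟨⟨_, hy'⟩, _⟩ hω; exact (F hω).2.2.2 hy')
  have e9 : prob p (X ∩ N ends a₁ a₂ v) = prob p (X ∩ Uᶜ) := prob_congr_sure p (by
    ext ω; simp only [Set.mem_inter_iff, mem_N, Set.mem_compl_iff]
    constructor
    · rintro ⟨⟨hx, _, hu⟩, hω⟩; exact ⟨⟨hx, hu⟩, hω⟩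
    · rintro ⟨⟨hx, hu⟩, hω⟩; exact ⟨⟨hx, (F hω).2.1, hu⟩, hω⟩)
  have e10 : prob p (N ends a₁ a₂ v) = prob p Uᶜ := prob_congr_sure p (by
    ext ω; simp only [Set.mem_inter_iff, mem_N, Set.mem_compl_iff]
    constructor
    · rintro ⟨⟨_, hu⟩, hω⟩; exact ⟨hu, hω⟩
    · rintro ⟨hu, hω⟩; exact ⟨⟨(F hω).2.1, hu⟩, hω⟩)
  unfold KPrimeHolds kprimeForm
  rw [e1, e2, e3, e4, e5, e6, e7, e8, e9, e10]
  simp only [mul_zero, zero_mul, sub_zero, one_mul, zero_add, sub_self]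
  have key := vdBK_pair p hp ends a₁ b y v
  have hmono : prob p (X ∩ W ∩ Uᶜ) ≤ prob p (Uᶜ ∩ W ∩ (X ∪ Cv)) := by
    apply prob_mono hp
    intro ω hω
    simp only [Set.mem_inter_iff, Set.mem_union, Set.mem_compl_iff] at hω ⊢
    exact ⟨⟨hω.2, hω.1.2⟩, Or.inl hω.1.1⟩
  have e11 : W ∩ Uᶜ = Uᶜ ∩ W := Set.inter_comm _ _
  rw [e11] at key
  have h0 := prob_nonneg hp Uᶜ
  nlinarith [key, hmono, h0]

omit [Fintype E] [DecidableEq E] [Fintype V] [DecidableEq V] [IsStrictOrderedRing R] in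
/-- On the sure set with `y ∈ root` and `a₁, v ∉ root`: `a₂ ↔ y`, `a₂ ↮ a₁`, `a₂ ↮ v`. -/
lemma sure_facts_y (hex : Exhausted p ends a₂) (h1 : a₁ ∉ root p ends a₂) (hv : v ∉ root p ends a₂)
    (hy : y ∈ root p ends a₂) {ω : Config E} (hω : ω ∈ sureSet p) :
    ¬ Conn ends ω a₂ a₁ ∧ ¬ Conn ends ω a₁ a₂ ∧ ¬ Conn ends ω a₂ v ∧ Conn ends ω a₂ y :=
  ⟨fun h => h1 (mem_root_of_conn p hex hω h), fun h => h1 (mem_root_of_conn p hex hω (conn_symm h)),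
    fun h => hv (mem_root_of_conn p hex hω h), conn_of_mem_root p hω hy⟩

omit [Fintype V] in
/-- **Degenerate base case `y ∈ root`** (the root exhausted, `a₁, v ∉ root`): `y ∈ C₂` surely, the
class `(0,1)` is empty and the form vanishes identically. -/
theorem kprime_of_exhausted_y (hex : Exhausted p ends a₂) (h1 : a₁ ∉ root p ends a₂)
    (hv : v ∉ root p ends a₂) (hy : y ∈ root p ends a₂) : KPrimeHolds ends a₁ a₂ b v y p := by
  have F := fun {ω : Config E} (hω : ω ∈ sureSet p) => sure_facts_y hex h1 hv hy hω
  set U := connEvent ends a₁ v with hU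
  set X := connEvent ends a₁ b with hX
  have e3 : prob p (connEvent ends a₂ y ∩ S ends a₁ a₂ v) = prob p (S ends a₁ a₂ v) :=
    prob_congr_sure p (by
      ext ω; simp only [Set.mem_inter_iff, mem_connEvent]
      constructor
      · rintro ⟨⟨_, hs⟩, hω⟩; exact ⟨hs, hω⟩
      · rintro ⟨hs, hω⟩; exact ⟨⟨(F hω).2.2.2, hs⟩, hω⟩)
  have e5 : prob p (cls01e ends a₁ a₂ b v y) = 0 := prob_eq_zero_of_inter_sureSet_eq_empty p (by
    ext ω; simp only [cls01e, Set.mem_inter_iff, mem_S, mem_connEvent, Set.mem_compl_iff,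
      Set.mem_union, Set.mem_empty_iff_false, iff_false, not_and]
    rintro ⟨⟨⟨_, hw⟩, hs⟩, _⟩ hω
    exact hs.1 (conn_trans (F hω).2.2.2 (conn_symm hw)))
  have e6 : prob p (cls01 ends a₁ a₂ v y) = 0 := prob_eq_zero_of_inter_sureSet_eq_empty p (by
    ext ω; simp only [cls01, Set.mem_inter_iff, mem_S, mem_connEvent, Set.mem_compl_iff,
      Set.mem_empty_iff_false, iff_false, not_and]
    rintro ⟨⟨_, hw⟩, hs⟩ hω
    exact hs.1 (conn_trans (F hω).2.2.2 (conn_symm hw)))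
  have e7 : prob p (U ∩ connEvent ends a₂ y ∩ X ∩ Ω ends a₁ a₂) = prob p (U ∩ X ∩ Ω ends a₁ a₂) :=
    prob_congr_sure p (by
      ext ω; simp only [Set.mem_inter_iff, mem_connEvent]
      constructor
      · rintro ⟨⟨⟨⟨hu, _⟩, hx⟩, hΩ⟩, hω⟩; exact ⟨⟨⟨hu, hx⟩, hΩ⟩, hω⟩
      · rintro ⟨⟨⟨hu, hx⟩, hΩ⟩, hω⟩; exact ⟨⟨⟨⟨hu, (F hω).2.2.2⟩, hx⟩, hΩ⟩, hω⟩)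
  have e8 : prob p (U ∩ connEvent ends a₂ y ∩ Ω ends a₁ a₂) = prob p (U ∩ Ω ends a₁ a₂) :=
    prob_congr_sure p (by
      ext ω; simp only [Set.mem_inter_iff, mem_connEvent]
      constructor
      · rintro ⟨⟨⟨hu, _⟩, hΩ⟩, hω⟩; exact ⟨⟨hu, hΩ⟩, hω⟩
      · rintro ⟨⟨hu, hΩ⟩, hω⟩; exact ⟨⟨⟨hu, (F hω).2.2.2⟩, hΩ⟩, hω⟩)
  unfold KPrimeHolds kprimeForm
  rw [e3, e5, e6, e7, e8]
  nlinarith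

end Base

end KPrime

end Summit.Ventures.PercRepro2
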